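import Summits.BirchSwinnertonDyer.BirchSwinnertonDyer.Theorems.ByReductionTypeAtTwoRankOnePerrinRiouElementAtTwo
import HarnessLib

/-!
# Route `ByReductionTypeAtTwo`, crux `RankOneAtTwoBigImageOddLocal` (item stmt-BirchSwinnertonDyer-23715): receptacles GIVEN the
# Perrin-Riou leading-term prediction 55A — the NORM of the Perrin-Riou element and «`[T¹]L♯` is a `2`-adic unit ⟺ `padicLogOrd(P) = 1`»

HONEST FRAMING (cell `bsd-f1-sign2`, planner seat `-an` g51, MEMO-an v2.22 §55 (55.7a), the cell's TURNKEY T-an-63 done in-house).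
Everything here is an IMPLICATION from the closed constant `PerrinRiouLeadingTermAtTwo` (55A, `@[conjecture]`, BSD₂-strength, NOT
proved) of `ByReductionTypeAtTwoRankOnePerrinRiouElementAtTwo.lean`; nothing is asserted about `L`-functions unconditionally and
nothing is booked.  CONTENT: on the ODD LOCUS of the crux (`Tam(W)` odd, `[W(ℚ) : ℤP]` odd, the period ratio `ϖ` a `2`-adic unit) and
with the Katz-residue datum `‖v‖₂ = ½` (AN62 52A₀, census 900/900), 55A gives
  `‖B(a)·c₁♯ − A(a)·c₁♭‖₂ = 4·‖q‖₂·‖ℓ‖₂²`                       (`norm_prComb_eq_of_leadingTerm`; = 55B in norm form, DERIVED)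
and, because `B(a)·c₁♯ − A(a)·c₁♭ ≡ c₁♯ (mod 2)` (`norm_prComb_sub_le`),
  `c₁♯ = [T¹]L♯ ∈ ℤ₂^×  ⟺  ‖q‖₂·‖ℓ‖₂² = ¼`                      (`sharpUnit_iff_of_leadingTerm`)
  `c₁♯ ∈ ℤ₂^×  ⟺  padicLogOrd W 2 ι P = 1`   when `‖q‖₂ = 1`   (`sharpUnit_iff_padicLogOrd_eq_one_of_leadingTerm`)
— the `T = 0` half of the cell's «`c♯` odd ⟺ `i₂(P) = 0 ∧ Ш[2] = 0`» (MEMO-an 47E) with NO σ-function and NO `2`-adic height: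
GIVEN 55A, whether Sprung's `L♯` has a unit linear coefficient is decided by `q = Ш_an` and `log_ω P` alone.  CENSUS (MEMO-an §55.4,
`Cruxes/…/CensusAN57.md`): on the 273 locus classes `4005 ≤ N ≤ 7811` (all `Ш_an = 1`), `c₁♯` is a unit on exactly the 207 with
`padicLogOrd = 1`; 0 exceptions.  Also recorded: `v₂ ℓ = padicLogOrd` (`valuation_prLog_eq`), `‖log₂ 5‖₂ = ¼`, odd casts are units.
References: as in the parent file (Bernardi–Perrin-Riou 1993; Perrin-Riou, Ann. Inst. Fourier 43 (1993); Sprung arXiv:1512.09362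
Conj. 4.14; Kobayashi, Invent. math. 191 (2013) Cor. 1.3(ii)); Gouvêa, p-adic Numbers, Prop. 5.7.8.
-/

set_option autoImplicit false

noncomputable section

open scoped Classical MatrixGroups ModularForm

open CongruenceSubgroup PowerSeries WeierstrassCurve Literature.NumberTheory.EllipticCurves
  Literature.NumberTheory.EllipticCurves.ModularForms Literature.NumberTheory.EllipticCurves.Sprung2017
  Literature.NumberTheory.EllipticCurves.Rank1Residual

namespace Summit.BirchSwinnertonDyer.BirchSwinnertonDyer.Theorems.PerrinRiouElementAtTwo

set_option linter.dupNamespace false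

/-! ### Receptacles GIVEN 55A (T-an-63 in-house): the norm of the Perrin-Riou element and «`c₁♯` is a unit» -/

-- Odd integers are `2`-adic units: the tree has this as `…GenusExact.TwinSwap.DyadicOrdinary.norm_intCast_padic_eq_one_of_not_two_dvd`
-- and `…DepletionAtTwo.norm_intCast_eq_one_of_odd` (other routes' theorem modules, not imported here); the three uses below inline
-- the two-line argument `Padic.norm_int_le_one` + `Padic.norm_intCast_lt_one_iff`.

/-- `‖log₂ 5‖₂ = ¼` (`v₂ log₂ 5 = 2`). [cite: Gouvea1993PadicNumbers, §5.7 Prop. 5.7.8] -/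
theorem norm_padicLog_two_five : ‖padicLog 2 5‖ = 4⁻¹ := by
  have h4 : ‖(4 : ℚ_[2])‖ = 4⁻¹ := by
    have h := Padic.norm_p_pow (p := 2) 2
    have e4 : ((2 : ℕ) : ℚ_[2]) ^ 2 = 4 := by norm_num
    rw [e4] at h
    rw [h]; norm_num
  have hL := norm_padicLog_two_five_add_four_le
  have hlt : ‖padicLog 2 5 + 4‖ < ‖(4 : ℚ_[2])‖ := by rw [h4]; exact lt_of_le_of_lt hL (by norm_num)
  have := Padic.add_eq_max_of_ne (q := padicLog 2 5 + 4) (r := -4) (by rw [norm_neg]; exact hlt.ne)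
  rw [show padicLog 2 5 + 4 + -4 = padicLog 2 5 by ring, norm_neg] at this
  rw [this, max_eq_right hlt.le, h4]

/-- THE PR SCALAR ON THE ODD LOCUS: `‖Tam·q/(ϖ·m²·log₂ 5)‖₂ = 4·‖q‖₂` when `Tam(W)` and `m` are odd and `ϖ` is a `2`-adic unit.
[folklore] -/
theorem norm_prScalar_eq (W : WeierstrassCurve ℚ) {q ϖ : ℚ} {m : ℕ} (hT : Odd W.tamagawaProduct)
    (hϖ : ‖(ϖ : ℚ_[2])‖ = 1) (hm : Odd m) : ‖prScalar W q ϖ m‖ = 4 * ‖(q : ℚ_[2])‖ := by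
  unfold prScalar
  have hunit : ∀ k : ℤ, ¬ (2 : ℤ) ∣ k → ‖(k : ℚ_[2])‖ = 1 := fun k hk =>
    le_antisymm (Padic.norm_int_le_one (p := 2) k) (not_lt.mp (by rw [Padic.norm_intCast_lt_one_iff]; exact_mod_cast hk))
  have hTn : ‖(W.tamagawaProduct : ℚ_[2])‖ = 1 := by
    have h := hunit (W.tamagawaProduct : ℤ) (by obtain ⟨j, hj⟩ := hT; omega)
    simpa using h
  have hmn : ‖(m : ℚ_[2])‖ = 1 := by
    have h := hunit (m : ℤ) (by obtain ⟨j, hj⟩ := hm; omega)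
    simpa using h
  rw [norm_div, norm_mul, norm_mul, norm_mul, norm_pow, hTn, hmn, hϖ,
    norm_padicLog_two_five, one_pow, one_mul, one_mul, one_mul]
  rw [div_eq_iff (by norm_num : (4⁻¹ : ℝ) ≠ 0)]
  ring

/-- **GIVEN 55A, THE NORM OF THE PERRIN-RIOU ELEMENT**: on the odd locus (`Tam(W)`, `[W(ℚ):ℤP]` odd, `ϖ` a `2`-adic unit) and with
the Katz residue datum `‖v‖₂ = ½` (AN62 52A₀), `‖B·c₁♯ − A·c₁♭‖₂ = 4·‖q‖₂·‖ℓ‖₂²` — i.e. 55B in norm form, derived (not assumed).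
[folklore] -/
theorem norm_prComb_eq_of_leadingTerm (h : PerrinRiouLeadingTermAtTwo)
    {N : ℕ} [NeZero N] (f : CuspForm (Gamma0 N) 2) (W : WeierstrassCurve ℚ) [W.IsElliptic] [W.IsGloballyMinimal]
    (Lsharp Lflat : IwasawaAlgebra 2) (q ϖ : ℚ) (ι : ℚ →+* ℚ_[2]) (P : (W.baseChange ℚ).toAffine.Point) (u v : ℚ_[2])
    (hss : GoodSS W 2) (hrk : W.analyticRank = 1) (hnf : IsNewformOf W f)
    (hper : (ϖ : ℝ) * W.realPeriodRat = ModularForms.plusPeriod f)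
    (hpair : IsSprungPair f 2 (W.frobeniusTrace 2) Lsharp Lflat) (hsha : shaAn W = (q : ℂ)) (hkz : IsKatzColumnAtTwo W u v)
    (hP : ¬ IsOfFinAddOrder P) (hodd : Odd (AddSubgroup.zmultiples P).index)
    (hT : Odd W.tamagawaProduct) (hϖ : ‖(ϖ : ℚ_[2])‖ = 1) (hv : ‖v‖ = 2⁻¹) :
    ‖prComb (W.frobeniusTrace 2) Lsharp Lflat‖ = 4 * ‖(q : ℚ_[2])‖ * ‖prLog W ι P‖ ^ 2 := by
  have e := h f W Lsharp Lflat q ϖ ι P u v hss hrk hnf hper hpair hsha hkz hP hodd.pos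
  have ha : Even (W.frobeniusTrace 2) := even_iff_two_dvd.mpr (by exact_mod_cast hss.2)
  have h3 : ‖(3 : ℚ_[2]) - (W.frobeniusTrace 2 : ℚ_[2])‖ = 1 := by
    have hodd3 : ¬ (2 : ℤ) ∣ (3 - W.frobeniusTrace 2) := by
      obtain ⟨k, hk⟩ := ha; omega
    have := le_antisymm (Padic.norm_int_le_one (p := 2) (3 - W.frobeniusTrace 2))
      (not_lt.mp (by rw [Padic.norm_intCast_lt_one_iff]; exact_mod_cast hodd3))
    push_cast at this
    exact this
  have h2 : ‖(2 : ℚ_[2])‖ = 2⁻¹ := by simpa using Padic.norm_p (p := 2)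
  rw [e, norm_neg, norm_div, norm_mul, norm_mul, norm_mul, norm_pow, norm_pow, h2, h3,
    norm_prScalar_eq W hT hϖ hodd, hv]
  field_simp

/-- Ultrametric transfer of unit-hood across a difference of norm `≤ ½`. [folklore] -/
theorem norm_eq_one_iff_of_norm_sub_le_half {x y : ℚ_[2]} (hxy : ‖x - y‖ ≤ 2⁻¹) : ‖x‖ = 1 ↔ ‖y‖ = 1 := by
  have key : ∀ {a b : ℚ_[2]}, ‖a - b‖ ≤ 2⁻¹ → ‖b‖ = 1 → ‖a‖ = 1 := by
    intro a b hab hb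
    have hlt : ‖a - b‖ < ‖b‖ := by rw [hb]; exact lt_of_le_of_lt hab (by norm_num)
    have := Padic.add_eq_max_of_ne (q := a - b) (r := b) hlt.ne
    rw [sub_add_cancel] at this
    rw [this, max_eq_right hlt.le, hb]
  refine ⟨fun hx => key (by rwa [norm_sub_rev]) hx, fun hy => key hxy hy⟩

/-- **«`c₁♯` IS A UNIT» GIVEN 55A (T-an-63 in-house).**  On the odd locus with `‖v‖₂ = ½`:
`[T¹]L♯ ∈ ℤ₂^× ⟺ ‖q‖₂·‖ℓ‖₂² = ¼` (`PR ≡ c₁♯ (mod 2)` by `norm_prComb_sub_le`, then `norm_prComb_eq_of_leadingTerm`). [folklore] -/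
theorem sharpUnit_iff_of_leadingTerm (h : PerrinRiouLeadingTermAtTwo)
    {N : ℕ} [NeZero N] (f : CuspForm (Gamma0 N) 2) (W : WeierstrassCurve ℚ) [W.IsElliptic] [W.IsGloballyMinimal]
    (Lsharp Lflat : IwasawaAlgebra 2) (q ϖ : ℚ) (ι : ℚ →+* ℚ_[2]) (P : (W.baseChange ℚ).toAffine.Point) (u v : ℚ_[2])
    (hss : GoodSS W 2) (hrk : W.analyticRank = 1) (hnf : IsNewformOf W f)
    (hper : (ϖ : ℝ) * W.realPeriodRat = ModularForms.plusPeriod f)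
    (hpair : IsSprungPair f 2 (W.frobeniusTrace 2) Lsharp Lflat) (hsha : shaAn W = (q : ℂ)) (hkz : IsKatzColumnAtTwo W u v)
    (hP : ¬ IsOfFinAddOrder P) (hodd : Odd (AddSubgroup.zmultiples P).index)
    (hT : Odd W.tamagawaProduct) (hϖ : ‖(ϖ : ℚ_[2])‖ = 1) (hv : ‖v‖ = 2⁻¹) :
    ‖((coeff 1 Lsharp : ℤ_[2]) : ℚ_[2])‖ = 1 ↔ ‖(q : ℚ_[2])‖ * ‖prLog W ι P‖ ^ 2 = 4⁻¹ := by
  have ha : Even (W.frobeniusTrace 2) := even_iff_two_dvd.mpr (by exact_mod_cast hss.2)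
  have hn := norm_prComb_eq_of_leadingTerm h f W Lsharp Lflat q ϖ ι P u v hss hrk hnf hper hpair hsha hkz hP hodd hT hϖ hv
  rw [← norm_eq_one_iff_of_norm_sub_le_half (norm_prComb_sub_le ha Lsharp Lflat), hn]
  constructor
  · intro h1; linarith
  · intro h1; linarith

/-- `v₂ ℓ = padicLogOrd(P)`: the valuation of `ℓ = log_ω(m₀P_ι)/m₀` is the tree's `padicLogOrd W 2 ι P` (when `ℓ ≠ 0`). [folklore] -/
theorem valuation_prLog_eq (W : WeierstrassCurve ℚ) [W.IsElliptic] [W.IsGloballyMinimal] (ι : ℚ →+* ℚ_[2])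
    (P : (W.baseChange ℚ).toAffine.Point) (h0 : prLog W ι P ≠ 0) :
    (prLog W ι P).valuation = padicLogOrd W 2 ι P := by
  unfold prLog at *
  set X := (W.baseChange ℚ_[2]).padicLogPoint (formalIndex W 2 • padicPointOf W 2 ι P) with hX
  have hm : ((formalIndex W 2 : ℕ) : ℚ_[2]) ≠ 0 := by
    intro hm; rw [hm, div_zero] at h0; exact h0 rfl
  have hX0 : X ≠ 0 := by
    intro hz; rw [hz, zero_div] at h0; exact h0 rfl
  have hq0 : X / (formalIndex W 2 : ℚ_[2]) ≠ 0 := div_ne_zero hX0 hm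
  have hmul : X = X / (formalIndex W 2 : ℚ_[2]) * (formalIndex W 2 : ℚ_[2]) := by field_simp
  have hval := Padic.valuation_mul hq0 hm
  rw [← hmul, Padic.valuation_natCast] at hval
  unfold padicLogOrd
  rw [← hX]
  omega

/-- **«`c₁♯` IS A UNIT ⟺ `padicLogOrd(P) = 1`» GIVEN 55A, on the odd locus with `Ш_an` a `2`-adic unit** (`‖q‖₂ = 1`), `‖v‖₂ = ½`,
`ℓ ≠ 0`: the `T = 0` half of the cell's 47E with NO σ-height (MEMO-an §55.1; census 207/207 locus classes). [folklore] -/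
theorem sharpUnit_iff_padicLogOrd_eq_one_of_leadingTerm (h : PerrinRiouLeadingTermAtTwo)
    {N : ℕ} [NeZero N] (f : CuspForm (Gamma0 N) 2) (W : WeierstrassCurve ℚ) [W.IsElliptic] [W.IsGloballyMinimal]
    (Lsharp Lflat : IwasawaAlgebra 2) (q ϖ : ℚ) (ι : ℚ →+* ℚ_[2]) (P : (W.baseChange ℚ).toAffine.Point) (u v : ℚ_[2])
    (hss : GoodSS W 2) (hrk : W.analyticRank = 1) (hnf : IsNewformOf W f)
    (hper : (ϖ : ℝ) * W.realPeriodRat = ModularForms.plusPeriod f)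
    (hpair : IsSprungPair f 2 (W.frobeniusTrace 2) Lsharp Lflat) (hsha : shaAn W = (q : ℂ)) (hkz : IsKatzColumnAtTwo W u v)
    (hP : ¬ IsOfFinAddOrder P) (hodd : Odd (AddSubgroup.zmultiples P).index)
    (hT : Odd W.tamagawaProduct) (hϖ : ‖(ϖ : ℚ_[2])‖ = 1) (hv : ‖v‖ = 2⁻¹) (hq : ‖(q : ℚ_[2])‖ = 1)
    (hℓ : prLog W ι P ≠ 0) :
    ‖((coeff 1 Lsharp : ℤ_[2]) : ℚ_[2])‖ = 1 ↔ padicLogOrd W 2 ι P = 1 := by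
  rw [sharpUnit_iff_of_leadingTerm h f W Lsharp Lflat q ϖ ι P u v hss hrk hnf hper hpair hsha hkz hP hodd hT hϖ hv, hq, one_mul,
    ← valuation_prLog_eq W ι P hℓ]
  have hnorm : ‖prLog W ι P‖ = (2 : ℝ) ^ (-(prLog W ι P).valuation) := by
    have := Padic.norm_eq_zpow_neg_valuation hℓ
    simpa using this
  constructor
  · intro hsq
    have hhalf : ‖prLog W ι P‖ = 2⁻¹ := by
      have := (pow_left_inj₀ (norm_nonneg _) (by norm_num : (0 : ℝ) ≤ 2⁻¹) two_ne_zero).mp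
        (show ‖prLog W ι P‖ ^ 2 = (2⁻¹ : ℝ) ^ 2 by rw [hsq]; norm_num)
      exact this
    rw [hnorm, show (2⁻¹ : ℝ) = 2 ^ (-(1 : ℤ)) by norm_num] at hhalf
    have := zpow_right_injective₀ (by norm_num : (0 : ℝ) < 2) (by norm_num : (2 : ℝ) ≠ 1) hhalf
    omega
  · intro h1
    rw [hnorm, h1]; norm_num

end Summit.BirchSwinnertonDyer.BirchSwinnertonDyer.Theorems.PerrinRiouElementAtTwo
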